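import Mathlib
import Summits.ResolutionOfSingularities.ResolutionOfSingularities.Theorems.HomologicalConductorPersistenceSurfaceSaturationResidualFourGorenstein
import Summits.ResolutionOfSingularities.ResolutionOfSingularities.Theorems.HomologicalConductorPersistenceSurfaceLevelFreeRestSingular
import HarnessLib

/-!
# Rung S-2 `PersistenceSurface` (stmt-ResolutionOfSingularities-19970) — THE DOOR OF RECORD after the Gorenstein /
# complete-intersection exemption: `PersistenceSurface` ⇐ {`Sat₄` at NON-Gorenstein stages, CSP‴, L-other′ at singular steps}

Route `ResolutionOfSingularities/HomologicalConductor`, chain W4.4b, rung S-2 `PersistenceSurface`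
(stmt-ResolutionOfSingularities-19970), registered skeleton 1a77c002 (stubs `stub_saturationFourSurfaceResidualFour`,
`stub_completedStepPersistenceRationalNormal'`, `stub_levelFourPersistenceNonnormalOrNonrational'`).
[OURS · bookkeeping over LANDED tree lemmas; AI-written, weaker than expert review; NOT a statement of the manuscript
under study (Hironaka 2017) and no statement of that manuscript is used.]  DEF-FREE; every premise is a hypothesis.

One theorem, `persistenceSurface_of_nonGorensteinSat_of_completedStep'_of_restSingular`, concluding the ROUTE DECL BY
NAME from exactly the content left open by this hand's files (p794696 … p796996):

* (NG) `Sat₄` — `ca ⊆ caAt 4` — at the stages `T_m` that are NOT Gorenstein (`¬ ∀ W f.g., ∀ i ≥ 3, Extⁱ(W, T_m) = 0`),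
  not regular, not monic-hypersurface localisations, not edim-candidates, of Krull dimension `2`, with a singular
  successor (`saturationFourSurfaceResidual₄_of_nonGorenstein`, p795782; Gorenstein stages by
  `…PersistenceSurfaceSaturationGorenstein`, complete intersections by `…HypersurfaceSectionExt`);
* CSP‴ `CompletedStepPersistenceRationalNormal'` (unchanged typed conjecture of the chain);
* (L′) the level-free transfer `caAt 4 (T_m) ⊆ ca (T_(m+1))` on the class «stage `0` NOT (normal-rational or
  regular)», only at steps INTO a singular stage from a two-dimensional stage
  (`levelFourPersistenceNonnormalOrNonrational'_of_singularSucc`, p795210);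

composed with the door `persistenceSurface_of_residual₄_of_completedStep'_of_rest'` (p522486 lineage).  The audit
classifies it `proof.conditional` (credits nothing); it is the kernel statement of where the rung stands.
-/

noncomputable section

-- single-problem summit: the doubled namespace component `ResolutionOfSingularities` is forced
set_option linter.dupNamespace false

namespace Summit.ResolutionOfSingularities.ResolutionOfSingularities.Theorems.HomologicalConductor.PersistenceSurfaceDoorNonGorenstein

open CategoryTheory
open Summit.ResolutionOfSingularities.ResolutionOfSingularities.Theorems
open Summit.ResolutionOfSingularities.ResolutionOfSingularities.Theorems.NoZeno.Birth
open Summit.ResolutionOfSingularities.ResolutionOfSingularities.Theorems.HomologicalConductor.PersistenceSurfaceSaturationResidual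
open Summit.ResolutionOfSingularities.ResolutionOfSingularities.Theorems.HomologicalConductor.PersistenceSurfaceSaturationResidualThree
open Summit.ResolutionOfSingularities.ResolutionOfSingularities.Theorems.HomologicalConductor.PersistenceSurfaceSaturationResidualFour
open Summit.ResolutionOfSingularities.ResolutionOfSingularities.Theorems.HomologicalConductor.PersistenceSurfaceSaturationResidualFourGorenstein
open Summit.ResolutionOfSingularities.ResolutionOfSingularities.Theorems.HomologicalConductor.PersistenceSurfaceCompletedStepLevelFree
open Summit.ResolutionOfSingularities.ResolutionOfSingularities.Theorems.HomologicalConductor.PersistenceSurfaceLevelFreeRestSingular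

/-- **Door of record (end of hand leafhand-res-homologicalconduct-2-g0).**  `PersistenceSurface` (the route decl, by
name) follows from: (NG) `Sat₄` at the NON-Gorenstein residual stages, CSP‴, and (L′) the level-free transfer on the class
Σ6 ∪ Σ8 at the steps into a singular stage from a two-dimensional stage.  Nothing is asserted; every premise is a
hypothesis (typed Props of the chain or inline). [cite: BrunsHerzog1998, Thm. 3.3.10; IyengarTakahashi2014, §2] -/
theorem persistenceSurface_of_nonGorensteinSat_of_completedStep'_of_restSingular
    (hNG : ∀ p : ℕ, p.Prime → ∀ (k K : Type) [Field k] [CharP k p] [Field K] [Algebra k K]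
      (O : ValuationSubring K) (A : Subalgebra k K), (∀ c : k, algebraMap k K c ∈ O) → A.FG →
      IsFractionRing ↥A K → A.toSubring ≤ O.toSubring → ringKrullDim ↥A ≤ 2 → ∀ m : ℕ,
      ¬ (∀ (W : ModuleCat.{0} ↥(tower O A m)), Module.Finite ↥(tower O A m) W → ∀ i : ℕ, 3 ≤ i →
          ∀ e : CategoryTheory.Abelian.Ext.{0} W (ModuleCat.of ↥(tower O A m) ↥(tower O A m)) i, e = 0) →
      ¬ IsRegularLocalRing ↥(tower O A m) → ¬ IsMonicHypersurfaceLocalization k 2 ↥(tower O A m) →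
      ¬ IsEdimHypersurfaceCandidate 2 ↥(tower O A m) → ¬ IsRegularLocalRing ↥(tower O A (m + 1)) →
      ringKrullDim ↥(tower O A m) = (2 : ℕ) →
      {x : K | ∃ hx : x ∈ tower O A m, ∃ n : ℕ, ∀ i : ℕ, n ≤ i → ∀ (M N : ModuleCat.{0} ↥(tower O A m)),
          Module.Finite ↥(tower O A m) M → Module.Finite ↥(tower O A m) N →
            ∀ e : CategoryTheory.Abelian.Ext.{0} M N i, (⟨x, hx⟩ : ↥(tower O A m)) • e = 0} ⊆
        {x : K | ∃ hx : x ∈ tower O A m, ∀ i : ℕ, 4 ≤ i → ∀ (M N : ModuleCat.{0} ↥(tower O A m)),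
          Module.Finite ↥(tower O A m) M → Module.Finite ↥(tower O A m) N →
            ∀ e : CategoryTheory.Abelian.Ext.{0} M N i, (⟨x, hx⟩ : ↥(tower O A m)) • e = 0})
    (hC : CompletedStepPersistenceRationalNormal')
    (hL : ∀ p : ℕ, p.Prime → ∀ (k K : Type) [Field k] [CharP k p] [Field K] [Algebra k K]
      (O : ValuationSubring K) (A : Subalgebra k K), (∀ c : k, algebraMap k K c ∈ O) → A.FG →
      IsFractionRing ↥A K → A.toSubring ≤ O.toSubring → ringKrullDim ↥A ≤ 2 →
      ¬ ((IsIntegrallyClosed ↥(tower O A 0) ∧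
          Literature.AlgebraicGeometry.Resolution.HasRationalSingularity ↥(tower O A 0)) ∨
        IsRegularLocalRing ↥(tower O A 0)) →
      ∀ m : ℕ, ¬ IsRegularLocalRing ↥(tower O A (m + 1)) → ringKrullDim ↥(tower O A m) = (2 : ℕ) →
      {x : K | ∃ hx : x ∈ tower O A m, ∀ i : ℕ, 4 ≤ i → ∀ (M N : ModuleCat.{0} ↥(tower O A m)),
          Module.Finite ↥(tower O A m) M → Module.Finite ↥(tower O A m) N →
            ∀ e : CategoryTheory.Abelian.Ext.{0} M N i, (⟨x, hx⟩ : ↥(tower O A m)) • e = 0} ⊆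
        ca (tower O A (m + 1))) :
    Summit.ResolutionOfSingularities.ResolutionOfSingularities.Theses.HomologicalConductor.PersistenceSurface :=
  persistenceSurface_of_residual₄_of_completedStep'_of_rest' (saturationFourSurfaceResidual₄_of_nonGorenstein hNG)
    hC (levelFourPersistenceNonnormalOrNonrational'_of_singularSucc hL)

end Summit.ResolutionOfSingularities.ResolutionOfSingularities.Theorems.HomologicalConductor.PersistenceSurfaceDoorNonGorenstein

end
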